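import Literature.Computability.Cryptography.PeriodFindingSums
import Mathlib.Analysis.SpecialFunctions.Trigonometric.Bounds
import Mathlib.Analysis.Complex.Trigonometric
import HarnessLib

/-!
# Fourier sampling of a pseudo-periodic table: the autocorrelation mass of a comb

Topic `Computability/Cryptography`; continues `PeriodFindingSums.lean` (`corrMass`, `chr`).
Theorem-and-definition file (no named facts). This is the finite-sum heart of **Hallgren's period
finding for an irrational period** (Hallgren 2002/2007; Jozsa 2003, §10, Thm. 6 with Lemma 3): if
the level sets of a table `F` on `[0, Q)` are *combs* — the level set through `v₀` is
`{r_0 < r_1 < ⋯ < r_{p−1}}` with `|r_l − (v₀ + lS)| < 1` for a real pitch `S ≥ 1` (Jozsa's "weak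
periodicity" `f(k) = f(k + [lS])`, §10 Definition) — then at every character `c` within `1/2` of a
small multiple `kQ/S` of `Q/S` (`k ≤ S/30`) each comb contributes `|∑_l e^{2πi c r_l/Q}| ≥ p/12`
(`norm_fibreSum_ge`), so that the autocorrelation mass — `Q²` times the probability of reading `c`
after "compute `F`, Fourier transform, measure" — is at least `#(good starts) · (p_min/12)²`
(`corrMass_ge_of_combs`; Jozsa 2003, proof of Thm. 6: `prob(j) ≥ c/S` for `j = ⌊kq/S⌉`).

The analysis is Jozsa's (op. cit. pp. 19–21), made quantitative with explicit constants:

* `third_mul_le_sin` — `sin x ≥ x/3` on `[0, 2]` (Jordan's inequality `Real.mul_le_sin` on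
  `[0, π/2]`, reflected on `[π/2, 2]`);
* `norm_sum_exp_ge` — `|∑_{l<p} e^{2πi a l}| ≥ p/3` when `p|a| ≤ 3/5` (geometric sum
  `sin(πap)/sin(πa)`; op. cit. Lemma 3 with `ξ = 0`);
* `norm_sum_exp_perturb_ge` — `|∑_{l<p} e^{2πi (a l + ξ_l)}| ≥ p/12` when moreover
  `|ξ_l| ≤ 1/(8π)` (op. cit. Lemma 3: "`ξ(l)`-perturbations of evenly spaced points"; here by the
  triangle inequality `|e^{2πiξ} − 1| ≤ 2π|ξ|` instead of the printed geometric argument);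
* `IsComb Q S F v₀ p` and **`norm_fibreSum_ge`**, **`corrMass_ge_of_combs`** (op. cit. proof of
  Thm. 6, eqs. (j1)–(j2): `j[lS]/q = εS l/q + (kδ_l/S + εδ_l/q) (mod 1)`).

## References

* R. Jozsa, *Notes on Hallgren's efficient quantum algorithm for solving Pell's equation*,
  arXiv:quant-ph/0302134 (2003), §10 (Definition of weak periodicity, Thm. 6, Lemmas 2–3).
  [Jozsa2003]
* S. Hallgren, *Polynomial-time quantum algorithms for Pell's equation and the principal ideal
  problem*, J. ACM 54 (2007), Art. 4, §3. [Hallgren2007]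
-/

noncomputable section

namespace Literature.Computability.Cryptography

namespace PeriodFinding

open Complex Finset Real

/-! ### Trigonometric bounds -/

/-- `x/3 ≤ sin x` for `0 ≤ x ≤ 2` (Jordan's inequality, reflected beyond `π/2`). [folklore] -/
theorem third_mul_le_sin {x : ℝ} (h0 : 0 ≤ x) (h2 : x ≤ 2) : x / 3 ≤ Real.sin x := by
  have hπ3 := Real.pi_gt_three
  have hπ4 := Real.pi_le_four
  by_cases hx : x ≤ π / 2
  · have h := Real.mul_le_sin h0 hx
    have e : 2 / π * x - x / 3 = x * (6 - π) / (3 * π) := by field_simp; ring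
    have : 0 ≤ x * (6 - π) / (3 * π) := div_nonneg (mul_nonneg h0 (by linarith)) (by positivity)
    linarith
  · push Not at hx
    have h1 : 0 ≤ π - x := by linarith [Real.pi_gt_d2]
    have h1' : π - x ≤ π / 2 := by linarith
    have h := Real.mul_le_sin h1 h1'
    rw [Real.sin_pi_sub] at h
    have hkey : 2 / π * (π - x) ≥ 2 / π * (π - 2) := by
      apply mul_le_mul_of_nonneg_left (by linarith) (by positivity)
    have h3 : 2 / π * (π - 2) = 2 - 4 / π := by field_simp; ring
    have h4 : 4 / π ≤ 4 / 3 := div_le_div_of_nonneg_left (by norm_num) (by norm_num) hπ3.le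
    linarith

/-- `|x|/3 ≤ |sin x|` for `|x| ≤ 2`. [folklore] -/
theorem abs_third_le_abs_sin {x : ℝ} (h : |x| ≤ 2) : |x| / 3 ≤ |Real.sin x| := by
  rcases le_or_gt 0 x with hx | hx
  · rw [abs_of_nonneg hx] at h ⊢
    exact (third_mul_le_sin hx h).trans (le_abs_self _)
  · rw [abs_of_neg hx] at h ⊢
    have := third_mul_le_sin (by linarith : (0 : ℝ) ≤ -x) h
    rw [Real.sin_neg] at this
    exact this.trans (neg_le_abs _)

/-! ### Geometric sums of unit complex numbers -/

/-- The unit complex number `e^{2πi t}`. [folklore] -/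
theorem norm_cexp_two_pi_mul_I (t : ℝ) : ‖cexp (2 * π * I * t)‖ = 1 := by
  rw [show (2 * π * I * t : ℂ) = ((2 * π * t : ℝ) : ℂ) * I by push_cast; ring, Complex.norm_exp_ofReal_mul_I]

/-- `‖e^{2πi t} − 1‖ = 2|sin(π t)|`. [folklore] -/
theorem norm_cexp_two_pi_mul_I_sub_one (t : ℝ) : ‖cexp (2 * π * I * t) - 1‖ = 2 * |Real.sin (π * t)| := by
  rw [show (2 * π * I * t : ℂ) = I * ((2 * π * t : ℝ) : ℂ) by push_cast; ring, Complex.norm_exp_I_mul_ofReal_sub_one]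
  rw [show (2 * π * t) / 2 = π * t by ring, Real.norm_eq_abs, abs_mul, abs_two]

/-- `‖e^{2πi t} − 1‖ ≤ 2π|t|`. [folklore] -/
theorem norm_cexp_two_pi_mul_I_sub_one_le (t : ℝ) : ‖cexp (2 * π * I * t) - 1‖ ≤ 2 * π * |t| := by
  rw [norm_cexp_two_pi_mul_I_sub_one]
  have := Real.abs_sin_le_abs (x := π * t)
  rw [abs_mul, abs_of_pos Real.pi_pos] at this
  linarith

/-- **Evenly spaced points over at most `3/5` of a turn add up**: `‖∑_{l<p} e^{2πi a l}‖ ≥ p/3` when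
`p|a| ≤ 3/5` (the geometric sum `sin(πap)/sin(πa)` with `sin y ≥ y/3` on `[0, 2]` and
`sin y ≤ y`). [cite: Jozsa2003, §10 Lemma 3 (unperturbed case)] -/
theorem norm_sum_exp_ge {a : ℝ} {p : ℕ} (h : (p : ℝ) * |a| ≤ 3 / 5) :
    (p : ℝ) / 3 ≤ ‖∑ l ∈ range p, cexp (2 * π * I * (a * l))‖ := by
  rcases Nat.eq_zero_or_pos p with hp | hp
  · subst hp; simp
  have hp' : (0 : ℝ) < p := by exact_mod_cast hp
  by_cases ha : a = 0
  · subst ha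
    simp only [Complex.ofReal_zero, zero_mul, mul_zero, Complex.exp_zero, sum_const, card_range,
      nsmul_eq_mul, mul_one, Complex.norm_natCast]
    linarith
  -- `z = e^{2πi a} ≠ 1` since `0 < |a| < 1`
  set z : ℂ := cexp (2 * π * I * a) with hz
  have hterm : ∀ l ∈ range p, cexp (2 * π * I * (a * l)) = z ^ l := by
    intro l _
    rw [hz, ← Complex.exp_nat_mul]
    congr 1; ring
  rw [sum_congr rfl hterm]
  have ha1 : |a| < 1 := by
    have : (1 : ℝ) ≤ p := by exact_mod_cast hp
    nlinarith [abs_nonneg a]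
  have hsin : Real.sin (π * a) ≠ 0 := by
    intro h0
    rw [Real.sin_eq_zero_iff] at h0
    obtain ⟨n, hn⟩ := h0
    have : (n : ℝ) = a := by
      have := congrArg (· / π) hn
      simpa [mul_comm, Real.pi_ne_zero] using this
    rw [← this] at ha1 ha
    have : |(n : ℝ)| < 1 := ha1
    have hn0 : n = 0 := by
      have : |n| < 1 := by exact_mod_cast this
      have := abs_lt.mp this
      omega
    exact ha (by rw [hn0]; simp)
  have hz1 : z ≠ 1 := by
    intro h1
    have : ‖z - 1‖ = 0 := by rw [h1, sub_self, norm_zero]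
    rw [hz, norm_cexp_two_pi_mul_I_sub_one] at this
    exact hsin (by simpa using this)
  rw [geom_sum_eq hz1, norm_div]
  have hnum : ‖z ^ p - 1‖ = 2 * |Real.sin (π * (a * p))| := by
    rw [hz, ← Complex.exp_nat_mul, show (p : ℂ) * (2 * π * I * a) = 2 * π * I * ((a * p : ℝ) : ℂ) by push_cast; ring,
      norm_cexp_two_pi_mul_I_sub_one]
  have hden : ‖z - 1‖ = 2 * |Real.sin (π * a)| := by rw [hz, norm_cexp_two_pi_mul_I_sub_one]
  rw [hnum, hden]
  have hden_pos : 0 < 2 * |Real.sin (π * a)| := by positivity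
  rw [le_div_iff₀ hden_pos]
  -- `|sin(π a p)| ≥ π |a| p / 3` and `|sin (π a)| ≤ π |a|`
  have h1 : |π * (a * p)| / 3 ≤ |Real.sin (π * (a * p))| := by
    apply abs_third_le_abs_sin
    rw [abs_mul, abs_of_pos Real.pi_pos, abs_mul, abs_of_pos hp']
    have hap : |a| * p ≤ 3 / 5 := by rw [mul_comm]; exact h
    calc π * (|a| * p) ≤ 3.15 * (3 / 5) :=
          mul_le_mul Real.pi_lt_d2.le hap (by positivity) (by norm_num)
      _ ≤ 2 := by norm_num
  have h2 : |Real.sin (π * a)| ≤ π * |a| := by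
    have := Real.abs_sin_le_abs (x := π * a)
    rwa [abs_mul, abs_of_pos Real.pi_pos] at this
  rw [abs_mul, abs_of_pos Real.pi_pos, abs_mul, abs_of_pos hp'] at h1
  calc (p : ℝ) / 3 * (2 * |Real.sin (π * a)|) ≤ (p : ℝ) / 3 * (2 * (π * |a|)) := by
        apply mul_le_mul_of_nonneg_left _ (by positivity); linarith
    _ = 2 * (π * (|a| * p) / 3) := by ring
    _ ≤ 2 * |Real.sin (π * (a * p))| := by linarith

/-- **Perturbed evenly spaced points** (Jozsa's Lemma 3): if `p|a| ≤ 3/5` and `|ξ_l| ≤ 1/(8π)`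
then `‖∑_{l<p} e^{2πi (a l + ξ_l)}‖ ≥ p/12`. [cite: Jozsa2003, §10 Lemma 3] -/
theorem norm_sum_exp_perturb_ge {a : ℝ} {p : ℕ} {ξ : ℕ → ℝ} (h : (p : ℝ) * |a| ≤ 3 / 5)
    (hξ : ∀ l < p, |ξ l| ≤ 1 / (8 * π)) :
    (p : ℝ) / 12 ≤ ‖∑ l ∈ range p, cexp (2 * π * I * (a * l + ξ l))‖ := by
  set T := ∑ l ∈ range p, cexp (2 * π * I * (a * l + ξ l)) with hT
  set U := ∑ l ∈ range p, cexp (2 * π * I * (a * l)) with hU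
  have hU' := norm_sum_exp_ge h
  rw [← hU] at hU'
  have hdiff : ‖T - U‖ ≤ p / 4 := by
    rw [hT, hU, ← sum_sub_distrib]
    refine (norm_sum_le _ _).trans ?_
    have hb : ∀ l ∈ range p, ‖cexp (2 * π * I * (a * l + ξ l)) - cexp (2 * π * I * (a * l))‖ ≤ 1 / 4 := by
      intro l hl
      have e : cexp (2 * π * I * (a * l + ξ l)) - cexp (2 * π * I * (a * l)) =
          cexp (2 * π * I * (a * l)) * (cexp (2 * π * I * ξ l) - 1) := by
        rw [mul_sub, mul_one, ← Complex.exp_add]; congr 1; ring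
      rw [e, norm_mul, show (2 * π * I * (a * l) : ℂ) = 2 * π * I * ((a * l : ℝ) : ℂ) by push_cast; ring,
        norm_cexp_two_pi_mul_I, one_mul]
      refine (norm_cexp_two_pi_mul_I_sub_one_le _).trans ?_
      have := hξ l (mem_range.mp hl)
      have hπ := Real.pi_pos
      calc 2 * π * |ξ l| ≤ 2 * π * (1 / (8 * π)) := by apply mul_le_mul_of_nonneg_left this; positivity
        _ = 1 / 4 := by field_simp; ring
    refine (sum_le_sum hb).trans ?_
    rw [sum_const, card_range, nsmul_eq_mul]
    linarith
  have := norm_sub_norm_le U T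
  rw [← norm_neg (U - T), neg_sub] at this
  linarith

/-! ### Comb level sets -/

variable {Ω : Type*} [DecidableEq Ω]

/-- **The level set of `F` through `v₀` is a comb of `p` teeth and pitch `S` on `[0, Q)`**: it is
`{r_0, …, r_{p−1}}` (distinct) with `|r_l − (v₀ + lS)| < 1` — Jozsa's weak periodicity
`F(v₀) = F(v₀ + [lS])` together with injectivity within a period, for the start `v₀`.
[cite: Jozsa2003, §10 (Definition, weakly periodic; Prop. 36)] -/
def IsComb (Q : ℕ) (S : ℝ) (F : ℕ → Ω) (v₀ p : ℕ) : Prop :=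
  ∃ r : ℕ → ℕ, (∀ l < p, |(r l : ℝ) - (v₀ + l * S)| < 1) ∧ Set.InjOn r (Set.Iio p) ∧
    (range Q).filter (fun v => F v = F v₀) = (range p).image r

omit [DecidableEq Ω] in
/-- The character value at a tooth: `e^{2πi c r_l/Q} = e^{2πi c v₀/Q} e^{2πi (a l + ξ_l)}` with
`a = εS/Q`, `ξ_l = k e_l/S + ε e_l/Q`, where `c = kQ/S + ε`, `r_l = v₀ + lS + e_l` (the integer
`kl` drops out). [cite: Jozsa2003, §10 (proof of Thm. 6, the display after (j2))] -/
theorem chr_tooth {Q : ℕ} (hQ : 0 < Q) {S : ℝ} (hS : 0 < S) (c : ℤ) (k v₀ l : ℕ) (r e ε : ℝ)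
    (hr : r = v₀ + l * S + e) (hε : (c : ℝ) = k * Q / S + ε) :
    cexp (2 * π * I * ((c : ℂ) * r / Q)) =
      cexp (2 * π * I * ((c : ℂ) * v₀ / Q)) *
        cexp (2 * π * I * (((ε * S / Q : ℝ) : ℂ) * l + ((k * e / S + ε * e / Q : ℝ) : ℂ))) := by
  have hQ' : (Q : ℝ) ≠ 0 := by exact_mod_cast hQ.ne'
  have key : (c : ℝ) * r / Q = (c : ℝ) * v₀ / Q + (k * l : ℕ) + ((ε * S / Q) * l + (k * e / S + ε * e / Q)) := by
    rw [hr, hε]; push_cast; field_simp; ring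
  have h : (2 * π * I * ((c : ℂ) * r / Q) : ℂ) = 2 * π * I * ((c : ℂ) * v₀ / Q) + ((k * l : ℕ) : ℂ) * (2 * π * I) +
      2 * π * I * (((ε * S / Q : ℝ) : ℂ) * l + ((k * e / S + ε * e / Q : ℝ) : ℂ)) := by
    have h := congrArg (fun x : ℝ => (x : ℂ)) key
    push_cast at h ⊢
    linear_combination (2 * π * I) * h
  rw [h, Complex.exp_add, Complex.exp_add, Complex.exp_nat_mul_two_pi_mul_I, mul_one]

/-- **A comb has a large Fourier coefficient at every character near a small multiple of `Q/S`**: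
if the level set through `v₀` is a comb of `p` teeth and pitch `S ≥ 1` on `[0, Q)`,
`Q ≥ max(100, 5S + 5)`, `30k ≤ S` and `|c − kQ/S| ≤ 1/2`, then
`‖∑_{v < Q, F v = F v₀} e^{2πi c v/Q}‖ ≥ p/12`. [cite: Jozsa2003, §10 (proof of Thm. 6: prob(j) ≥ c/S)] -/
theorem norm_fibreSum_ge {Q : ℕ} {S : ℝ} {F : ℕ → Ω} {v₀ p k : ℕ} {c : ℤ}
    (hS : 1 ≤ S) (hQ : (100 : ℝ) ≤ Q) (hQS : 5 * S + 5 ≤ Q) (hcomb : IsComb Q S F v₀ p)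
    (hk : 30 * (k : ℝ) ≤ S) (hc : |(c : ℝ) - k * Q / S| ≤ 1 / 2) :
    (p : ℝ) / 12 ≤ ‖∑ v ∈ (range Q).filter (fun v => F v = F v₀), chr Q c v‖ := by
  obtain ⟨r, hr, hinj, hset⟩ := hcomb
  have hQpos : (0 : ℝ) < Q := by linarith
  have hQ0 : 0 < Q := by exact_mod_cast hQpos
  have hS0 : 0 < S := by linarith
  rw [hset, sum_image (fun x hx y hy h => hinj (mem_coe.mp hx |> mem_range.mp) (mem_coe.mp hy |> mem_range.mp) h)]
  set ε : ℝ := (c : ℝ) - k * Q / S with hεdef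
  have hterm : ∀ l ∈ range p, chr Q c (r l) =
      cexp (2 * π * I * ((c : ℂ) * v₀ / Q)) *
        cexp (2 * π * I * (((ε * S / Q : ℝ) : ℂ) * l +
          ((k * ((r l : ℝ) - (v₀ + l * S)) / S + ε * ((r l : ℝ) - (v₀ + l * S)) / Q : ℝ) : ℂ))) := by
    intro l _
    rw [chr_def]
    have := chr_tooth hQ0 hS0 c k v₀ l (r l) ((r l : ℝ) - (v₀ + l * S)) ε (by ring) (by rw [hεdef]; ring)
    push_cast at this ⊢
    rw [this]
  have hv₀ : ‖cexp (2 * π * I * ((c : ℂ) * v₀ / Q))‖ = 1 := by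
    rw [show (2 * π * I * ((c : ℂ) * v₀ / Q) : ℂ) = 2 * π * I * (((c : ℝ) * v₀ / Q : ℝ) : ℂ) by push_cast; ring]
    exact norm_cexp_two_pi_mul_I _
  rw [sum_congr rfl hterm, ← mul_sum, norm_mul, hv₀, one_mul]
  -- the hypotheses of the perturbation lemma
  have hteeth : ∀ l < p, (l : ℝ) * S < Q + 1 := by
    intro l hl
    have h1 := hr l hl
    have h2 : r l < Q := by
      have : r l ∈ (range p).image r := mem_image_of_mem r (mem_range.mpr hl)
      rw [← hset] at this
      exact mem_range.mp (mem_filter.mp this).1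
    have h2' : (r l : ℝ) + 1 ≤ Q := by exact_mod_cast h2
    have := (abs_lt.mp h1).1
    have hv : (0 : ℝ) ≤ v₀ := Nat.cast_nonneg _
    linarith
  have hpS : (p : ℝ) * S ≤ Q + 1 + S := by
    rcases Nat.eq_zero_or_pos p with hp | hp
    · subst hp; simp; linarith
    · have := hteeth (p - 1) (Nat.sub_lt hp one_pos)
      rw [Nat.cast_pred hp] at this
      linarith
  have hεb : |ε| ≤ 1 / 2 := hc
  have hpa : (p : ℝ) * |ε * S / Q| ≤ 3 / 5 := by
    rw [abs_div, abs_mul, abs_of_pos hS0, abs_of_pos hQpos]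
    have hp0 : (0 : ℝ) ≤ p := Nat.cast_nonneg _
    calc (p : ℝ) * (|ε| * S / Q) = (p * S) * |ε| / Q := by ring
      _ ≤ (Q + 1 + S) * (1 / 2) / Q := by
          apply div_le_div_of_nonneg_right _ hQpos.le
          exact mul_le_mul hpS hεb (abs_nonneg _) (by linarith)
      _ ≤ 3 / 5 := by
          rw [div_le_iff₀ hQpos]; linarith
  have hξb : ∀ l < p, |(k * ((r l : ℝ) - (v₀ + l * S)) / S + ε * ((r l : ℝ) - (v₀ + l * S)) / Q)| ≤ 1 / (8 * π) := by
    intro l hl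
    set el : ℝ := (r l : ℝ) - (v₀ + l * S) with hel
    have he : |el| ≤ 1 := (hr l hl).le
    have hk0 : (0 : ℝ) ≤ k := Nat.cast_nonneg _
    have h1 : |(k : ℝ) * el / S| ≤ 1 / 30 := by
      rw [abs_div, abs_mul, abs_of_nonneg hk0, abs_of_pos hS0, div_le_iff₀ hS0]
      nlinarith [abs_nonneg el]
    have h2 : |ε * el / Q| ≤ 1 / 200 := by
      rw [abs_div, abs_mul, abs_of_pos hQpos, div_le_iff₀ hQpos]
      nlinarith [abs_nonneg el, abs_nonneg ε]
    have hπ : 1 / 30 + 1 / 200 ≤ 1 / (8 * π) := by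
      rw [le_div_iff₀ (by positivity)]
      have := Real.pi_lt_d2
      nlinarith
    calc |(k : ℝ) * el / S + ε * el / Q| ≤ |(k : ℝ) * el / S| + |ε * el / Q| := abs_add_le _ _
      _ ≤ 1 / (8 * π) := by linarith
  exact norm_sum_exp_perturb_ge (ξ := fun l => k * ((r l : ℝ) - (v₀ + l * S)) / S + ε * ((r l : ℝ) - (v₀ + l * S)) / Q)
    hpa hξb

/-- **The autocorrelation mass of a pseudo-periodic table at a good character.** If every start
`v₀` in `G` (pairwise in different level sets, `G ⊆ [0, Q)`) has a comb level set with at least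
`p_min` teeth, then `corrMass Q F c ≥ #G · (p_min/12)²` for every `c` within `1/2` of `kQ/S`,
`30k ≤ S` (`S ≥ 1`, `Q ≥ max(100, 5S + 5)`): Jozsa's "`prob(j) ≥ c/S` for each
`j = ⌊kq/S⌉`, `k ≤ S/log S`", here with `k ≤ S/30` and the constant `1/144`.
[cite: Jozsa2003, §10 Thm. 6 (proof, eqs. (j1)–(j2) and Lemma 3)] -/
theorem corrMass_ge_of_combs {Q : ℕ} {S : ℝ} {F : ℕ → Ω} {k pmin : ℕ} {c : ℤ} (G : Finset ℕ)
    (hS : 1 ≤ S) (hQ : (100 : ℝ) ≤ Q) (hQS : 5 * S + 5 ≤ Q) (hk : 30 * (k : ℝ) ≤ S)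
    (hc : |(c : ℝ) - k * Q / S| ≤ 1 / 2) (hGQ : ∀ v₀ ∈ G, v₀ < Q) (hinj : Set.InjOn F G)
    (hG : ∀ v₀ ∈ G, ∃ p, pmin ≤ p ∧ IsComb Q S F v₀ p) :
    (G.card : ℝ) * ((pmin : ℝ) / 12) ^ 2 ≤ corrMass Q F c := by
  unfold corrMass
  have hsub : G.image F ⊆ (range Q).image F :=
    image_subset_image (fun v hv => mem_range.mpr (hGQ v hv))
  refine le_trans ?_ (sum_le_sum_of_subset_of_nonneg hsub fun _ _ _ => by positivity)
  rw [sum_image fun x hx y hy h => hinj hx hy h]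
  have hb : ∀ v₀ ∈ G, ((pmin : ℝ) / 12) ^ 2 ≤ ‖∑ v ∈ (range Q).filter (fun v => F v = F v₀), chr Q c v‖ ^ 2 := by
    intro v₀ hv₀
    obtain ⟨p, hp, hcomb⟩ := hG v₀ hv₀
    have h1 := norm_fibreSum_ge hS hQ hQS hcomb hk hc
    have h0 : (0 : ℝ) ≤ (pmin : ℝ) / 12 := by positivity
    have hp' : (pmin : ℝ) / 12 ≤ p / 12 := by
      apply div_le_div_of_nonneg_right _ (by norm_num); exact_mod_cast hp
    exact pow_le_pow_left₀ h0 (hp'.trans h1) 2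
  refine le_trans ?_ (sum_le_sum hb)
  rw [sum_const, nsmul_eq_mul]

end PeriodFinding

end Literature.Computability.Cryptography

end
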